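import Mathlib.Algebra.Group.Shrink
import Mathlib.Data.Countable.Small
import Mathlib.Data.ZMod.Basic
import Literature.Algebra.Homology.GroupCohomologyULift
import Literature.Algebra.Homology.FiniteEmbeddingProblemCohomology
import Literature.Topology.FourManifolds.AsphericalThreeManifoldProfiniteH3
import Literature.Topology.FourManifolds.AsphericalThreeManifoldGroupH3
import HarnessLib

/-!
# `H³(π̂₁(Z); ℤ/2) ≠ 0` for closed aspherical 3-manifolds: the named fact reduced to goodness
# (proofs companion of `AsphericalThreeManifoldProfiniteH3.lean`)

Topic `Literature/Topology/FourManifolds`.  The named fact `profinite_H3_ne_zero_of_aspherical`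
(Aschenbrenner–Friedl–Wilton, proof of Prop. 9.29: "Because `π₁(N₁)` is residually finite and
good, we have `H³(π̂₁(N₁); ℤ/2) ≅ H³(π₁(N₁); ℤ/2)` … But `H³(π₁(N₁); ℤ/2) ≅ H³(N₁; ℤ/2) ≅ ℤ/2`",
read at the finite level: some class on a finite quotient `Q` of `π₁(Z)` has non-zero inflation to
every finite quotient over `Q`) packages THREE steps of the printed argument.  Two of them are
theorems of the tree:

* `H³(π₁(Z); 𝔽₂) ≠ 0` for a closed orientable aspherical `3`-manifold —
  `nontrivial_groupCohomology_H3_of_aspherical` (`AsphericalThreeManifoldGroupH3.lean`: universal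
  cover, equivariant singular chains as a free resolution, `K(π, 1)` comparison, fundamental class
  mod `2`);
* the passage between the universe of the manifold (where `π₁(Z)`, its cohomology and the finite
  quotients delivered by goodness live) and finite groups in `Type` (over which the fact
  quantifies) — `Literature.Algebra.Homology.GroupCohomologyULift.exists_lower_class`.

This file proves the resulting REDUCTION: the fact follows from the single remaining input,
GOODNESS of closed aspherical 3-manifold groups in degree `3` with coefficients `𝔽₂` (AFW §6
(G.24): "the fundamental group of any compact 3-manifold is good" — Wilton–Zalesskii for graph
manifolds; Geometrisation, Agol, Kahn–Markovic, Wise, Przytycki–Wise and [GJZ08] otherwise;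
Cavendish in general), in the finite-level form "every class of `H³(π₁Z; 𝔽₂)` is inflated from a
finite quotient" (Serre, *Cohomologie galoisienne*, I §2.6 Ex. 1–2 with I §2.2 Cor. 1) — VERBATIM
the hypothesis `hgood` of `not_lift_fundamentalGroup_of_aspherical_of_good`
(`AsphericalThreeManifoldGroupNotProjectiveProofs.lean`).  So both named facts of this story,
`profinite_H3_ne_zero_of_aspherical` and `not_lift_fundamentalGroup_of_aspherical`, are ONE
application away from that single statement, which is not in the tree (it is where Perelman and
Agol–Wise enter).

## Content (all proved)

* `profinite_H3_ne_zero_of_aspherical_of_good_of_H3_ne_zero` — goodness (degree `3`, `𝔽₂`,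
  surjectivity of inflation) and `H³(π₁Z; 𝔽₂) ≠ 0` imply the fact.  PROOF: a non-zero
  `y ∈ H³(π₁Z; 𝔽₂)` is `π^* x` for a homomorphism `π` to a finite group `Q` (goodness); replace
  `Q` by the image of `π` (so `π` is surjective) and move it to `Type` (`Shrink`, finite types are
  small), carrying `x` along (`groupCohomology.map` along the isomorphism, then
  `exists_lower_class`); if the resulting class `x₀` died in a finite quotient `Q'` over `Q`, then,
  lifting `Q'` back to the universe of `Z` and pulling back to `π₁Z`, so would `y`.
* `profinite_H3_ne_zero_of_aspherical_of_good` — the fact from goodness alone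
  (`H³ ≠ 0` being the theorem `nontrivial_groupCohomology_H3_of_aspherical`).

## Sources

* M. Aschenbrenner, S. Friedl, H. Wilton, *3-Manifold Groups*, EMS (2015) = arXiv:1205.0202 (v3
  numbering), §6 (G.24), §9.13 proof of Prop. 9.29.  [AschenbrennerFriedlWilton2015]
* J-P. Serre, *Galois Cohomology* (1997), I §2.2 Prop. 8 Cor. 1, I §2.6 Ex. 1–2.  [Serre1997]

## NOT here

`profinite_H3_ne_zero_of_aspherical_holds` itself: by the theorems of this file it is exactly
goodness of closed aspherical 3-manifold groups in degree `3` (AFW (G.24): Geometrisation +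
Agol–Wise + [WZ10] / Cavendish), a theory absent from the tree.
-/

noncomputable section

open CategoryTheory groupCohomology
open scoped Manifold ContDiff

namespace Literature.Topology.FourManifolds

open Literature.Algebra.Homology Literature.Algebra.Homology.GroupCohomologyULift

universe u

/-- **`H³(π̂₁Z; ℤ/2) ≠ 0` (the named fact `profinite_H3_ne_zero_of_aspherical`, finite level) from
the two inputs of the printed proof** (Aschenbrenner–Friedl–Wilton, proof of Prop. 9.29, verbatim
for closed aspherical `N₁`: "Because `π₁(N₁)` … good, `H³(π̂₁(N₁); ℤ/2) ≅ H³(π₁(N₁); ℤ/2)` … But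
`H³(π₁(N₁); ℤ/2) ≅ H³(N₁; ℤ/2) ≅ ℤ/2`").  Write `G = π₁(Z, z)`, `𝔽₂ = ULift (ZMod 2)` (universe of
`Z`), `H³(-; 𝔽₂) = groupCohomology (Rep.trivial 𝔽₂ - 𝔽₂) 3`.
* `hgood` — the part of GOODNESS of `G` that is used (§6 (G.24); "good": `H^*(Ĝ; A) → H^*(G; A)`
  is an isomorphism for every finite `A`, Serre I §2.6 Ex. 2), namely surjectivity in degree `3`
  with coefficients `𝔽₂`, at the finite level (`H³(Ĝ; 𝔽₂) = lim_→ H³(Q; 𝔽₂)`, Serre I §2.2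
  Cor. 1): every `y ∈ H³(G; 𝔽₂)` is `π^* x` for some `x ∈ H³(Q; 𝔽₂)` along some homomorphism
  `π : G → Q` to a finite group — VERBATIM the hypothesis `hgood` of
  `not_lift_fundamentalGroup_of_aspherical_of_good`;
* `hH3` — `H³(G; 𝔽₂) ≠ 0` (proved in the tree: `nontrivial_groupCohomology_H3_of_aspherical`).
CONCLUSION: the named fact (same universe).  PROOF: take `y ≠ 0` and `π, x` with `π^* x = y`;
shrink `Q` to the image of `π` and then into `Type` (`Shrink`), transporting `x` along the group
isomorphism (`groupCohomology.map`) and down the universes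
(`GroupCohomologyULift.exists_lower_class`) to `x₀ ∈ H³(Q₀; ZMod 2)`; if `φ^* x₀ = 0` for a
finite quotient `π' : G ↠ Q'` with `φ ∘ π' = π₀`, then `(ULift φ)^*` kills the lifted class, and
pulling back further along `G → ULift Q'` kills `y = π^* x` — contradiction.
[cite: AschenbrennerFriedlWilton2015, §9.13 Prop. 9.29 (proof) with §6 (G.24); arXiv:1205.0202v3 numbering]
[cite: Serre1997, I §2.2 Prop. 8 Cor. 1, I §2.6 Ex. 1–2] -/
theorem profinite_H3_ne_zero_of_aspherical_of_good_of_H3_ne_zero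
    (hgood : ∀ (Z : Type u) [TopologicalSpace Z] [T2Space Z] [SecondCountableTopology Z]
      [ChartedSpace (EuclideanSpace ℝ (Fin 3)) Z] [IsManifold (𝓡 3) ∞ Z] [CompactSpace Z]
      [ConnectedSpace Z] (_ : IsOrientable (𝓡 3) Z) (z : Z),
      (∀ n : ℕ, 2 ≤ n → Subsingleton (HomotopyGroup (Fin n) Z z)) →
      ∀ y : groupCohomology
          (Rep.trivial (ULift.{u} (ZMod 2)) (FundamentalGroup Z z) (ULift.{u} (ZMod 2))) 3,
        ∃ (Q : Type u) (_ : Group Q) (_ : Finite Q) (π : FundamentalGroup Z z →* Q)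
          (x : groupCohomology (Rep.trivial (ULift.{u} (ZMod 2)) Q (ULift.{u} (ZMod 2))) 3),
          groupCohomology.map π
            (𝟙 (Rep.res π (Rep.trivial (ULift.{u} (ZMod 2)) Q (ULift.{u} (ZMod 2))))) 3 x = y)
    (hH3 : ∀ (Z : Type u) [TopologicalSpace Z] [T2Space Z] [SecondCountableTopology Z]
      [ChartedSpace (EuclideanSpace ℝ (Fin 3)) Z] [IsManifold (𝓡 3) ∞ Z] [CompactSpace Z]
      [ConnectedSpace Z] (_ : IsOrientable (𝓡 3) Z) (z : Z),
      (∀ n : ℕ, 2 ≤ n → Subsingleton (HomotopyGroup (Fin n) Z z)) →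
      Nontrivial (groupCohomology
        (Rep.trivial (ULift.{u} (ZMod 2)) (FundamentalGroup Z z) (ULift.{u} (ZMod 2))) 3)) :
    profinite_H3_ne_zero_of_aspherical.{u} := by
  intro Z _ _ _ _ _ _ _ hZ z hasph
  haveI := hH3 Z hZ z hasph
  obtain ⟨y, hy⟩ := exists_ne (0 : groupCohomology
    (Rep.trivial (ULift.{u} (ZMod 2)) (FundamentalGroup Z z) (ULift.{u} (ZMod 2))) 3)
  obtain ⟨Q, _, _, π, x, hx⟩ := hgood Z hZ z hasph y
  -- Step 1: replace `Q` by the image of `π`, so that `π` becomes surjective.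
  have hgen : ∀ f : FundamentalGroup Z z →* Q, f = π →
      map f (𝟙 (Rep.res f (Rep.trivial (ULift.{u} (ZMod 2)) Q (ULift.{u} (ZMod 2))))) 3 x
        = y := by
    rintro f rfl
    exact hx
  have hcomp : π.range.subtype.comp π.rangeRestrict = π := MonoidHom.ext fun _ => rfl
  have hxR := hgen _ hcomp
  rw [map_comp_id_id, CategoryTheory.comp_apply] at hxR
  -- `hxR : map π.rangeRestrict 𝟙 3 (map π.range.subtype 𝟙 3 x) = y`
  set xR := map π.range.subtype
    (𝟙 (Rep.res π.range.subtype (Rep.trivial (ULift.{u} (ZMod 2)) Q (ULift.{u} (ZMod 2))))) 3 x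
    with hxRdef
  -- Step 2: move the finite group `π.range` to `Type`, and the class along.
  haveI : Small.{0} π.range := inferInstance
  let Q₀ : Type := Shrink.{0} π.range
  haveI : Finite Q₀ := Finite.of_equiv _ (equivShrink π.range)
  let e : Q₀ ≃* π.range := Shrink.mulEquiv
  let π₀ : FundamentalGroup Z z →* Q₀ := e.symm.toMonoidHom.comp π.rangeRestrict
  have hπ₀ : Function.Surjective π₀ :=
    e.symm.surjective.comp (MonoidHom.rangeRestrict_surjective π)
  let ε : ULift.{u} Q₀ ≃* π.range := MulEquiv.ulift.trans e
  set X' : groupCohomology (trivialULift.{u} (ZMod 2) Q₀) 3 :=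
    map ε.toMonoidHom (𝟙 (Rep.res ε.toMonoidHom (Rep.res π.range.subtype
      (Rep.trivial (ULift.{u} (ZMod 2)) Q (ULift.{u} (ZMod 2)))))) 3 xR with hX'
  obtain ⟨x₀, hx₀⟩ := exists_lower_class.{u} (k := ZMod 2) (G := Q₀) 2 X'
  refine ⟨Q₀, inferInstance, inferInstance, π₀, x₀, hπ₀, ?_⟩
  intro Q' _ _ π' φ _ hφ h0
  have h1 := (hx₀ Q' φ).1 h0
  -- Step 3: pull back to `π₁(Z)`: the non-zero class `y` would vanish.
  have hfac : ε.toMonoidHom.comp ((uliftHom.{u} φ).comp (upHom π')) = π.rangeRestrict := by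
    ext g
    change ((e (φ (π' g)) : π.range) : Q) = π.rangeRestrict g
    have hg : φ (π' g) = π₀ g := DFunLike.congr_fun hφ g
    rw [hg]
    change ((e (e.symm (π.rangeRestrict g)) : π.range) : Q) = _
    rw [MulEquiv.apply_symm_apply]
  have hgen' : ∀ f : FundamentalGroup Z z →* π.range, f = π.rangeRestrict →
      map f (𝟙 (Rep.res f (Rep.res π.range.subtype
        (Rep.trivial (ULift.{u} (ZMod 2)) Q (ULift.{u} (ZMod 2)))))) 3 xR = y := by
    rintro f rfl
    exact hxR
  have H2 := hgen' _ hfac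
  rw [map_comp_id_id, CategoryTheory.comp_apply, map_comp_id_id, CategoryTheory.comp_apply,
    ← hX'] at H2
  have h1' : map (uliftHom.{u} φ) (𝟙 (Rep.res (uliftHom.{u} φ) (Rep.res ε.toMonoidHom
      (Rep.res π.range.subtype
        (Rep.trivial (ULift.{u} (ZMod 2)) Q (ULift.{u} (ZMod 2))))))) 3 X' = 0 := h1
  rw [h1', map_zero] at H2
  exact hy H2.symm

/-- **`H³(π̂₁Z; ℤ/2) ≠ 0` modulo GOODNESS only** (Aschenbrenner–Friedl–Wilton 2015, proof of
Prop. 9.29 with §6 (G.24)): the named fact `profinite_H3_ne_zero_of_aspherical` follows from the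
single remaining input `hgood` of `profinite_H3_ne_zero_of_aspherical_of_good_of_H3_ne_zero`
(surjectivity of `lim_→ H³(Q; 𝔽₂) → H³(π₁(Z); 𝔽₂)` over the finite quotients — cohomological
goodness of closed aspherical `3`-manifold groups in degree `3`; Geometrisation, Wilton–Zalesskii,
Agol, Wise, Przytycki–Wise, Cavendish; not in the tree), the topological input being the theorem
`nontrivial_groupCohomology_H3_of_aspherical`.  Hence
`profinite_H3_ne_zero_of_aspherical_holds` and `not_lift_fundamentalGroup_of_aspherical_holds`
(`not_lift_fundamentalGroup_of_aspherical_of_good`) are each one application of that statement.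
[cite: AschenbrennerFriedlWilton2015, §9.13 Prop. 9.29 (proof) with §6 (G.24); arXiv:1205.0202v3 numbering]
[cite: Serre1997, I §2.6 Ex. 1–2, I §2.2 Prop. 8 Cor. 1] -/
theorem profinite_H3_ne_zero_of_aspherical_of_good
    (hgood : ∀ (Z : Type u) [TopologicalSpace Z] [T2Space Z] [SecondCountableTopology Z]
      [ChartedSpace (EuclideanSpace ℝ (Fin 3)) Z] [IsManifold (𝓡 3) ∞ Z] [CompactSpace Z]
      [ConnectedSpace Z] (_ : IsOrientable (𝓡 3) Z) (z : Z),
      (∀ n : ℕ, 2 ≤ n → Subsingleton (HomotopyGroup (Fin n) Z z)) →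
      ∀ y : groupCohomology
          (Rep.trivial (ULift.{u} (ZMod 2)) (FundamentalGroup Z z) (ULift.{u} (ZMod 2))) 3,
        ∃ (Q : Type u) (_ : Group Q) (_ : Finite Q) (π : FundamentalGroup Z z →* Q)
          (x : groupCohomology (Rep.trivial (ULift.{u} (ZMod 2)) Q (ULift.{u} (ZMod 2))) 3),
          groupCohomology.map π
            (𝟙 (Rep.res π (Rep.trivial (ULift.{u} (ZMod 2)) Q (ULift.{u} (ZMod 2))))) 3 x = y) :
    profinite_H3_ne_zero_of_aspherical.{u} :=
  profinite_H3_ne_zero_of_aspherical_of_good_of_H3_ne_zero hgood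
    fun Z _ _ _ _ _ _ _ hZ z hasph => nontrivial_groupCohomology_H3_of_aspherical Z hZ z hasph

end Literature.Topology.FourManifolds
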